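import Literature.RepresentationTheory.ModularTensorCategories.SU2LevelK

/-!
# The `SU(2)_k` S-matrix is real symmetric and unitary: discrete sine orthogonality

Topic `Literature/RepresentationTheory/ModularTensorCategories` (definition item `defn-ModularDatum`;
first of the trigonometric `ModularDatum` axioms for the explicit `SU(2)_k` data of `SU2LevelK.lean`,
as prescribed by the review of the bundled-fact submission: PROVE them).

Main results (`r = k + 2`, labels `a, c ∈ Fin (k+1)`):
* `sum_cos_range`     — `Σ_{n<r} cos(π m n / r) = [m odd]` for an integer `m` with `2r ∤ m`
  (geometric sum of `e^{iπ m n/r}`);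
* `sum_sin_mul_sin`   — `Σ_{x} sin(π(a+1)(x+1)/r) sin(π(c+1)(x+1)/r) = (r/2) δ_{ac}`;
* `sMat_mul_sMat`     — `S² = 1` (all labels self-dual, so this is `S² = C`), `sMat_conjTranspose`
  (`S` real symmetric), `sMat_mul_conjTranspose` — `S Sᴴ = 1` (unitarity, i.e. modularity);
* `sum_qdim_sq`, `sMat_zero_left` — `Σ_a d_a² = r/(2 sin²(π/r))` and `S_{0a} = d_a / D`.
[cite: Gannon2023, eq. (6.2.2a) (S of A₁ level k) and Def. 6.1.6 (MD1: S unitary symmetric)]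
-/

noncomputable section

open Complex (I)
open Finset
open scoped Matrix ComplexConjugate

namespace Literature.RepresentationTheory.ModularTensorCategories.SU2LevelK

/-- `Re (2/(1-ζ)) = 1` for `ζ ≠ 1` on the unit circle. [folklore] -/
theorem re_two_div_one_sub {ζ : ℂ} (h1 : ‖ζ‖ = 1) (hne : ζ ≠ 1) : (2 / (1 - ζ)).re = 1 := by
  have hsq : ζ.re * ζ.re + ζ.im * ζ.im = 1 := by
    have := Complex.normSq_eq_norm_sq ζ
    rw [h1, one_pow, Complex.normSq_apply] at this
    exact this
  have hre : (1 - ζ).re ≠ 0 := by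
    intro h0
    simp only [Complex.sub_re, Complex.one_re, sub_eq_zero] at h0
    apply hne
    apply Complex.ext
    · simpa using h0.symm
    · have : ζ.im * ζ.im = 0 := by nlinarith [h0]
      simpa using this
  have hns : Complex.normSq (1 - ζ) = 2 * (1 - ζ).re := by
    rw [Complex.normSq_apply]
    simp only [Complex.sub_re, Complex.one_re, Complex.sub_im, Complex.one_im, zero_sub]
    nlinarith [hsq]
  rw [Complex.div_re, hns]
  simp only [Complex.re_ofNat, Complex.im_ofNat, zero_mul, zero_div, add_zero]
  field_simp

/-- `Σ_{n < k+2} cos(π m n/(k+2)) = 1` if `m` is odd and `= 0` if `m` is even, for an integer `m`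
not divisible by `2(k+2)` (real part of a geometric sum of `2(k+2)`-th roots of unity). [folklore] -/
theorem sum_cos_range (k : ℕ) (m : ℤ) (hm : ¬ ((2 * (k + 2 : ℕ) : ℤ) ∣ m)) :
    ∑ n ∈ range (k + 2), Real.cos (Real.pi * m * n / (k + 2)) = if Even m then 0 else 1 := by
  set φ : ℝ := Real.pi * m / (k + 2) with hφ
  set ζ : ℂ := Complex.exp ((φ : ℂ) * I) with hζ
  have hk : (0 : ℝ) < k + 2 := by positivity
  have hcos : ∀ n : ℕ, Real.cos (Real.pi * m * n / (k + 2)) = (ζ ^ n).re := fun n => by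
    rw [hζ, ← Complex.exp_nat_mul, ← mul_assoc]
    have : (n : ℂ) * (φ : ℂ) * I = ((n * φ : ℝ) : ℂ) * I := by push_cast; ring
    rw [this, Complex.exp_ofReal_mul_I_re, hφ]
    congr 1
    field_simp
  have hζ1 : ζ ≠ 1 := by
    intro h
    rw [hζ, Complex.exp_eq_one_iff] at h
    obtain ⟨n, hn⟩ := h
    have him := congrArg Complex.im hn
    simp only [Complex.mul_im, Complex.ofReal_re, Complex.I_im, mul_one, Complex.ofReal_im,
      Complex.I_re, mul_zero, add_zero, Complex.mul_re, Complex.intCast_re, Complex.intCast_im,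
      zero_mul, sub_zero, Complex.re_ofNat, Complex.im_ofNat] at him
    -- him : φ = n * (2 * π)  (up to the shape simp produced)
    apply hm
    refine ⟨n, ?_⟩
    have hπ : Real.pi ≠ 0 := Real.pi_ne_zero
    have key : (m : ℝ) = 2 * (k + 2) * n := by
      rw [hφ] at him
      field_simp at him
      nlinarith [him, Real.pi_pos]
    exact_mod_cast key
  have hkC : (k : ℂ) + 2 ≠ 0 := by exact_mod_cast hk.ne'
  have hζr : ζ ^ (k + 2) = (-1 : ℂ) ^ m := by
    rw [hζ, ← Complex.exp_nat_mul, ← Complex.exp_pi_mul_I, ← Complex.exp_int_mul]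
    congr 1
    rw [hφ]
    push_cast
    field_simp
  have hnorm : ‖ζ‖ = 1 := by rw [hζ]; exact Complex.norm_exp_ofReal_mul_I φ
  simp_rw [hcos]
  rw [← Complex.re_sum, geom_sum_eq hζ1, hζr]
  rcases Int.even_or_odd m with he | ho
  · rw [if_pos he, he.neg_one_zpow, sub_self, zero_div, Complex.zero_re]
  · rw [if_neg (Int.not_even_iff_odd.mpr ho), ho.neg_one_zpow,
      show (-1 - 1) / (ζ - 1) = 2 / (1 - ζ) by
        rw [← neg_div_neg_eq]; congr 1 <;> ring]
    exact re_two_div_one_sub hnorm hζ1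

/-- The same sum over the labels `x : Fin (k+1)` at `n = x + 1`:
`Σ_x cos(π m (x+1)/(k+2)) = -[m even]` for `2(k+2) ∤ m`. [folklore] -/
theorem sum_cos_labels (k : ℕ) (m : ℤ) (hm : ¬ ((2 * (k + 2 : ℕ) : ℤ) ∣ m)) :
    ∑ x : Fin (k + 1), Real.cos (Real.pi * m * ((x : ℕ) + 1) / (k + 2)) =
      if Even m then -1 else 0 := by
  have h := sum_cos_range k m hm
  rw [Finset.sum_range_succ'] at h
  simp only [Nat.cast_zero, mul_zero, zero_div, Real.cos_zero, Nat.cast_add, Nat.cast_one] at h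
  rw [Fin.sum_univ_eq_sum_range (fun x => Real.cos (Real.pi * m * (x + 1) / (k + 2))) (k + 1)]
  split_ifs at h ⊢ <;> linarith

/-- A nonzero integer of absolute value `< 2(k+2)` is not divisible by `2(k+2)`. [folklore] -/
theorem not_dvd_of_ne_zero_of_lt {k : ℕ} {m : ℤ} (h0 : m ≠ 0) (hlt : |m| < 2 * (k + 2 : ℕ)) :
    ¬ ((2 * (k + 2 : ℕ) : ℤ) ∣ m) := by
  rintro ⟨q, hq⟩
  rcases eq_or_ne q 0 with rfl | hq0
  · exact h0 (by simpa using hq)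
  · have : (2 * (k + 2 : ℕ) : ℤ) ≤ |m| := by
      rw [hq, abs_mul]
      have h1 : (1 : ℤ) ≤ |q| := Int.one_le_abs hq0
      have h2 : (0 : ℤ) ≤ |(2 * (k + 2 : ℕ) : ℤ)| := abs_nonneg _
      calc (2 * (k + 2 : ℕ) : ℤ) = |(2 * (k + 2 : ℕ) : ℤ)| * 1 := by
            rw [abs_of_nonneg (by positivity), mul_one]
        _ ≤ |(2 * (k + 2 : ℕ) : ℤ)| * |q| := by gcongr
    omega

/-- **Discrete orthogonality of sines**:
`Σ_{x ≤ k} sin(π(a+1)(x+1)/(k+2)) sin(π(c+1)(x+1)/(k+2)) = ((k+2)/2) δ_{ac}` for `a, c ≤ k`. [folklore] -/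
theorem sum_sin_mul_sin (k : ℕ) {a c : ℕ} (ha : a ≤ k) (hc : c ≤ k) :
    ∑ x : Fin (k + 1), Real.sin (Real.pi * (a + 1) * ((x : ℕ) + 1) / (k + 2)) *
        Real.sin (Real.pi * (c + 1) * ((x : ℕ) + 1) / (k + 2)) =
      if a = c then ((k : ℝ) + 2) / 2 else 0 := by
  -- product to sum
  have hps : ∀ x : Fin (k + 1),
      Real.sin (Real.pi * (a + 1) * ((x : ℕ) + 1) / (k + 2)) *
        Real.sin (Real.pi * (c + 1) * ((x : ℕ) + 1) / (k + 2)) =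
      (Real.cos (Real.pi * (((a : ℤ) - c : ℤ) : ℝ) * ((x : ℕ) + 1) / (k + 2)) -
        Real.cos (Real.pi * (((a : ℤ) + c + 2 : ℤ) : ℝ) * ((x : ℕ) + 1) / (k + 2))) / 2 := by
    intro x
    have e1 : Real.pi * (((a : ℤ) - c : ℤ) : ℝ) * ((x : ℕ) + 1) / (k + 2) =
        Real.pi * (a + 1) * ((x : ℕ) + 1) / (k + 2) - Real.pi * (c + 1) * ((x : ℕ) + 1) / (k + 2) := by
      push_cast; ring
    have e2 : Real.pi * (((a : ℤ) + c + 2 : ℤ) : ℝ) * ((x : ℕ) + 1) / (k + 2) =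
        Real.pi * (a + 1) * ((x : ℕ) + 1) / (k + 2) + Real.pi * (c + 1) * ((x : ℕ) + 1) / (k + 2) := by
      push_cast; ring
    rw [e1, e2, Real.cos_sub, Real.cos_add]
    ring
  simp_rw [hps]
  rw [← Finset.sum_div, Finset.sum_sub_distrib]
  have h2 : ¬ ((2 * (k + 2 : ℕ) : ℤ) ∣ ((a : ℤ) + c + 2)) :=
    not_dvd_of_ne_zero_of_lt (by omega) (by rw [abs_of_nonneg (by omega)]; push_cast; omega)
  rw [sum_cos_labels k _ h2]
  by_cases hac : a = c
  · subst hac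
    rw [if_pos rfl]
    have : ∑ x : Fin (k + 1), Real.cos (Real.pi * (((a : ℤ) - a : ℤ) : ℝ) * ((x : ℕ) + 1) / (k + 2)) =
        k + 1 := by simp
    rw [this, if_pos ⟨(a : ℤ) + 1, by ring⟩]
    ring
  · rw [if_neg hac]
    have h1 : ¬ ((2 * (k + 2 : ℕ) : ℤ) ∣ ((a : ℤ) - c)) :=
      not_dvd_of_ne_zero_of_lt (by omega) (by
        rcases le_or_gt c a with h | h
        · rw [abs_of_nonneg (by omega)]; push_cast; omega
        · rw [abs_of_neg (by omega)]; push_cast; omega)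
    rw [sum_cos_labels k _ h1]
    have hpar : Even ((a : ℤ) - c) ↔ Even ((a : ℤ) + c + 2) := by
      constructor
      · rintro ⟨t, ht⟩; exact ⟨t + c + 1, by omega⟩
      · rintro ⟨t, ht⟩; exact ⟨t - c - 1, by omega⟩
    by_cases he : Even ((a : ℤ) - c)
    · rw [if_pos he, if_pos (hpar.mp he)]; ring
    · rw [if_neg he, if_neg (fun h => he (hpar.mpr h))]; ring

variable (k : ℕ)

/-- Entries of `sMat` (unfolding). [cite: Gannon2023, eq. (6.2.2a)] -/
theorem sMat_apply (a b : Fin (k + 1)) : sMat k a b =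
    ((Real.sqrt (2 / (k + 2)) * Real.sin (Real.pi * ((a : ℕ) + 1) * ((b : ℕ) + 1) / (k + 2)) : ℝ) : ℂ) :=
  rfl

/-- `S` is real symmetric: `Sᴴ = S`. [cite: Gannon2023, Def. 6.1.6 (MD1) with (6.2.2a)] -/
theorem sMat_conjTranspose : (sMat k)ᴴ = sMat k := by
  ext a b
  rw [Matrix.conjTranspose_apply, sMat_apply, sMat_apply, Complex.star_def, Complex.conj_ofReal]
  congr 3
  ring

/-- **`S² = 1`** for `SU(2)_k` (hence `S² = C`, every label being self-dual).
[cite: Gannon2023, Def. 6.1.6 and (6.2.2a) ("for A₁ the matrix S is real and so C = id")] -/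
theorem sMat_mul_sMat : sMat k * sMat k = 1 := by
  ext a c
  rw [Matrix.mul_apply, Matrix.one_apply]
  simp only [sMat_apply]
  have hk : (0 : ℝ) < k + 2 := by positivity
  have hx : ∀ x : Fin (k + 1),
      ((Real.sqrt (2 / (k + 2)) * Real.sin (Real.pi * ((a : ℕ) + 1) * ((x : ℕ) + 1) / (k + 2)) : ℝ) : ℂ) *
        ((Real.sqrt (2 / (k + 2)) * Real.sin (Real.pi * ((x : ℕ) + 1) * ((c : ℕ) + 1) / (k + 2)) : ℝ) : ℂ) =
      (((2 / (k + 2)) * (Real.sin (Real.pi * ((a : ℕ) + 1) * ((x : ℕ) + 1) / (k + 2)) *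
        Real.sin (Real.pi * ((c : ℕ) + 1) * ((x : ℕ) + 1) / (k + 2))) : ℝ) : ℂ) := by
    intro x
    rw [← Complex.ofReal_mul]
    congr 1
    have hs : Real.sqrt (2 / (k + 2)) * Real.sqrt (2 / (k + 2)) = 2 / (k + 2) :=
      Real.mul_self_sqrt (by positivity)
    rw [show Real.pi * ((x : ℕ) + 1) * ((c : ℕ) + 1) / (k + 2) =
      Real.pi * ((c : ℕ) + 1) * ((x : ℕ) + 1) / (k + 2) by ring, mul_mul_mul_comm, hs]
  simp_rw [hx]
  rw [← Complex.ofReal_sum, ← Finset.mul_sum,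
    sum_sin_mul_sin k (Nat.lt_succ_iff.mp a.isLt) (Nat.lt_succ_iff.mp c.isLt)]
  by_cases hac : a = c
  · subst hac
    rw [if_pos rfl, if_pos rfl, show (2 : ℝ) / (k + 2) * ((k + 2) / 2) = 1 by field_simp,
      Complex.ofReal_one]
  · rw [if_neg (fun h => hac (Fin.ext h)), if_neg hac, mul_zero, Complex.ofReal_zero]

/-- **Unitarity of the `SU(2)_k` S-matrix** (`S Sᴴ = 1`), i.e. modularity of the `SU(2)_k` data.
[cite: Gannon2023, Def. 6.1.6 (MD1) with eq. (6.2.2a)] -/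
theorem sMat_mul_conjTranspose : sMat k * (sMat k)ᴴ = 1 := by
  rw [sMat_conjTranspose, sMat_mul_sMat]

/-- `Σ_a sin²(π(a+1)/(k+2)) = (k+2)/2`. [folklore] -/
theorem sum_sin_sq (k : ℕ) :
    ∑ x : Fin (k + 1), Real.sin (Real.pi * ((x : ℕ) + 1) / (k + 2)) ^ 2 = ((k : ℝ) + 2) / 2 := by
  have h := sum_sin_mul_sin k (a := 0) (c := 0) (Nat.zero_le k) (Nat.zero_le k)
  rw [if_pos rfl] at h
  rw [← h]
  refine Finset.sum_congr rfl (fun x _ => ?_)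
  rw [sq]
  congr 2 <;> push_cast <;> ring

/-- `Σ_a d_a² = (k+2) / (2 sin²(π/(k+2)))` for `d_a = [a+1]`. [folklore] -/
theorem sum_qdim_sq : ∑ a : Fin (k + 1), qdim k a ^ 2 =
    ((k : ℝ) + 2) / 2 / Real.sin (Real.pi / (k + 2)) ^ 2 := by
  have hsin : Real.sin (Real.pi / (k + 2)) ≠ 0 := by
    have := qInt_pos k (n := 1) le_rfl (by omega)
    unfold qInt at this
    intro h0
    rw [h0, div_zero] at this
    exact lt_irrefl _ this
  rw [eq_div_iff (pow_ne_zero 2 hsin), Finset.sum_mul, ← sum_sin_sq k]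
  refine Finset.sum_congr rfl (fun a _ => ?_)
  unfold qdim qInt
  rw [div_pow, div_mul_cancel₀ _ (pow_ne_zero 2 hsin)]
  congr 2
  push_cast
  ring

/-- **`S_{0a} = d_a / D`** with `D = √(Σ_b d_b²)` for the `SU(2)_k` data.
[cite: Kitaev2006, App. E.4 (s_{1x} = d_x/𝒟)] -/
theorem sMat_zero_left (a : Fin (k + 1)) :
    sMat k 0 a = ((qdim k a / Real.sqrt (∑ b : Fin (k + 1), qdim k b ^ 2) : ℝ) : ℂ) := by
  rw [sMat_apply]
  congr 1
  have hk : (0 : ℝ) < k + 2 := by positivity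
  have hsinpos : 0 < Real.sin (Real.pi / (k + 2)) := by
    apply Real.sin_pos_of_pos_of_lt_pi (by positivity)
    rw [div_lt_iff₀ hk]; nlinarith [Real.pi_pos]
  have hs2 : Real.sqrt (((k : ℝ) + 2) / 2) ≠ 0 := (Real.sqrt_pos.mpr (by positivity)).ne'
  have hs : Real.sqrt (2 / ((k : ℝ) + 2)) * Real.sqrt (((k : ℝ) + 2) / 2) = 1 := by
    rw [← Real.sqrt_mul (by positivity), show (2 : ℝ) / (k + 2) * ((k + 2) / 2) = 1 by field_simp,
      Real.sqrt_one]
  rw [sum_qdim_sq, Real.sqrt_div' _ (sq_nonneg _), Real.sqrt_sq hsinpos.le]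
  unfold qdim qInt
  rw [div_div_div_cancel_right₀ hsinpos.ne', eq_div_iff hs2, Fin.val_zero, Nat.cast_zero, zero_add,
    mul_one, mul_right_comm, hs, one_mul]
  congr 1
  push_cast
  ring

end Literature.RepresentationTheory.ModularTensorCategories.SU2LevelK
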